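import Summits.Schanuel.Schanuel.Theorems.ZilberEacGraphSurfaceAll
import HarnessLib

/-!
# Non-split surfaces over a graph base, VII: two unbalanced examples —
# `{x₁ = x₀², y₁ = x₀ y₀}` and `{x₁ = x₀², y₀² + y₁² = x₀ + 2}`

HONEST FRAMING.  Cell `pub-schanuel` (Zilber's Exponential-Algebraic Closedness, case ladder;
host summit Schanuel), seat 2, gen 17.  Two members of Mantova–Masser's case (dim-π-S-1-free)
whose fibre polynomial has an UNBALANCED lower-left edge (a single monomial of top `x`-degree on
the edge), hence outside the gen-16 theorems, decided by `unprojectedDense_graphSurface`: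
`{x₁ = x₀², y₁ = x₀ y₀}` (exponential points `e^{z²} = z e^{z}`, balance `e^{z² - z} ≍ z`, `μ = 1`)
and `{x₁ = x₀², y₀² + y₁² = x₀ + 2}` (`e^{2z} + e^{2z²} = z + 2`, balance `e^{2z²} ≍ z`,
`μ = 1/2`).  Both are certified to be in the case and to have Zariski-dense exponential points.
Instances of an OPEN question (PLMS 2024, §1 p. 5); NOT Schanuel's conjecture; `EC(3,2)` OPEN.
-/

noncomputable section

open Set Complex MvPolynomial
open Literature.NumberTheory.Transcendental Literature.ModelTheory.Zilber
open Literature.ModelTheory.ExponentialFields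

set_option linter.dupNamespace false

namespace Summit.Schanuel.Schanuel.Theorems

/-! ## Example A. `y₁ = x₀ y₀` over the parabola -/

/-- `y₁ - x y₀ = X₃¹ - (X₁X₂)` is a cyclic-cover polynomial of exponent `1`. -/
theorem gsex_PA_eq_cyclicCoverPoly :
    (X 2 - X 0 * X 1 : MvPolynomial (Fin 3) ℂ) =
      cyclicCoverPoly 1 (X 0 * X 1 : MvPolynomial (Fin 2) ℂ) := by
  rw [cyclicCoverPoly, pow_one, map_mul, rename_X, rename_X]
  rfl

/-- **`y₁ - x₀ y₀` is irreducible** (Eisenstein at the prime `y₀`... i.e. `X₁X₂` has the simple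
prime factor `X₁`). -/
theorem irreducible_PA : Irreducible (X 2 - X 0 * X 1 : MvPolynomial (Fin 3) ℂ) := by
  rw [gsex_PA_eq_cyclicCoverPoly]
  refine irreducible_cyclicCoverPoly one_pos (π := X 0) MvPolynomial.X_prime
    (dvd_mul_right _ _) ?_
  rintro ⟨u, hu⟩
  have h1 : (X 1 : MvPolynomial (Fin 2) ℂ) = X 0 * u := by
    have h2 : (X 0 : MvPolynomial (Fin 2) ℂ) * X 1 = X 0 * (X 0 * u) := by rw [hu]; ring
    exact mul_left_cancel₀ (MvPolynomial.X_ne_zero 0) h2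
  have h3 := congrArg (MvPolynomial.eval ![(0 : ℂ), 1]) h1
  simp at h3

/-- `y₁ - x₀ y₀` has the monomials `y₁` and `x₀y₀`, of different `y₁`-degree. -/
theorem PA_support_pair :
    ∃ m ∈ (X 2 - X 0 * X 1 : MvPolynomial (Fin 3) ℂ).support,
      ∃ m' ∈ (X 2 - X 0 * X 1 : MvPolynomial (Fin 3) ℂ).support, m 2 ≠ m' 2 := by
  classical
  have hne : (Finsupp.single (2 : Fin 3) 1 : Fin 3 →₀ ℕ) ≠
      Finsupp.single 0 1 + Finsupp.single 1 1 := by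
    intro h
    have := DFunLike.congr_fun h 2
    simp at this
  refine ⟨Finsupp.single 2 1, ?_, Finsupp.single 0 1 + Finsupp.single 1 1, ?_, ?_⟩
  · rw [MvPolynomial.mem_support_iff, MvPolynomial.coeff_sub, MvPolynomial.coeff_X,
      show (X 0 * X 1 : MvPolynomial (Fin 3) ℂ) =
        MvPolynomial.monomial (Finsupp.single 0 1 + Finsupp.single 1 1) 1 by
          rw [MvPolynomial.X, MvPolynomial.X, MvPolynomial.monomial_mul, mul_one],
      MvPolynomial.coeff_monomial, if_neg hne.symm]
    simp
  · rw [MvPolynomial.mem_support_iff, MvPolynomial.coeff_sub, MvPolynomial.coeff_X,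
      if_neg hne,
      show (X 0 * X 1 : MvPolynomial (Fin 3) ℂ) =
        MvPolynomial.monomial (Finsupp.single 0 1 + Finsupp.single 1 1) 1 by
          rw [MvPolynomial.X, MvPolynomial.X, MvPolynomial.monomial_mul, mul_one],
      MvPolynomial.coeff_monomial, if_pos rfl]
    simp
  · simp

/-- Torus fibres of `y₁ = x₀ y₀` over every `t ≠ 0` (`y = (1, t)`). -/
theorem PA_torusFibres_infinite :
    Set.Infinite {t : ℂ | ∃ c : Fin 2 → ℂ, c 0 ≠ 0 ∧ c 1 ≠ 0 ∧
      MvPolynomial.eval ![t, c 0, c 1] (X 2 - X 0 * X 1 : MvPolynomial (Fin 3) ℂ) = 0} := by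
  refine ((Set.finite_singleton (0 : ℂ)).infinite_compl).mono ?_
  intro t ht
  refine ⟨![1, t], by simp, by simpa using ht, ?_⟩
  simp

/-- **Example A.**  The non-split surface `{x₁ = x₀², y₁ = x₀ y₀} ⊆ ℂ² × ℂ²` — fibre polynomial
`y₁ - x₀y₀` with an unbalanced edge — is in Mantova–Masser's case (dim-π-S-1-free) and its
exponential points `(z, z², e^z, e^{z²})` with `e^{z²} = z e^{z}` are Zariski dense. (new) -/
theorem unprojectedDensityQuestion_instance_parabola_y1_eq_x0y0 :
    MMCaseDimPiOneFree {w : Fin 2 ⊕ Fin 2 → ℂ |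
        w (Sum.inl 1) = (Polynomial.X ^ 2 : Polynomial ℂ).eval (w (Sum.inl 0)) ∧
        MvPolynomial.eval ![w (Sum.inl 0), w (Sum.inr 0), w (Sum.inr 1)]
          (X 2 - X 0 * X 1 : MvPolynomial (Fin 3) ℂ) = 0} ∧
      UnprojectedDense {w : Fin 2 ⊕ Fin 2 → ℂ |
        w (Sum.inl 1) = (Polynomial.X ^ 2 : Polynomial ℂ).eval (w (Sum.inl 0)) ∧
        MvPolynomial.eval ![w (Sum.inl 0), w (Sum.inr 0), w (Sum.inr 1)]
          (X 2 - X 0 * X 1 : MvPolynomial (Fin 3) ℂ) = 0} :=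
  unprojectedDensityQuestion_instance_graphSurface (Polynomial.X ^ 2) _ (by simp) irreducible_PA
    PA_support_pair PA_torusFibres_infinite

/-- The same surface in plain coordinates: `{x₁ = x₀², y₁ = x₀ y₀}` has Zariski-dense exponential
points. (new) -/
theorem unprojectedDense_parabola_y1_eq_x0y0 :
    UnprojectedDense {w : Fin 2 ⊕ Fin 2 → ℂ |
      w (Sum.inl 1) = w (Sum.inl 0) ^ 2 ∧ w (Sum.inr 1) = w (Sum.inl 0) * w (Sum.inr 0)} := by
  have h := unprojectedDensityQuestion_instance_parabola_y1_eq_x0y0.2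
  have hset : {w : Fin 2 ⊕ Fin 2 → ℂ |
        w (Sum.inl 1) = (Polynomial.X ^ 2 : Polynomial ℂ).eval (w (Sum.inl 0)) ∧
        MvPolynomial.eval ![w (Sum.inl 0), w (Sum.inr 0), w (Sum.inr 1)]
          (X 2 - X 0 * X 1 : MvPolynomial (Fin 3) ℂ) = 0} =
      {w : Fin 2 ⊕ Fin 2 → ℂ |
        w (Sum.inl 1) = w (Sum.inl 0) ^ 2 ∧ w (Sum.inr 1) = w (Sum.inl 0) * w (Sum.inr 0)} := by
    ext w
    simp only [Set.mem_setOf_eq, Polynomial.eval_pow, Polynomial.eval_X, map_sub, map_mul,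
      MvPolynomial.eval_X, Matrix.cons_val_zero, Matrix.cons_val_one, Matrix.head_cons,
      Matrix.cons_val_two, Matrix.tail_cons, sub_eq_zero]
  rw [← hset]
  exact h

/-! ## Example B. `y₀² + y₁² = x₀ + 2` over the parabola -/

set_option simprocs false in
/-- `-(y₀² + y₁² - x - 2)` is the variable swap `x ↔ y₁` of the cyclic-cover polynomial
`X₃ - (X₁² + X₂² - 2)`. -/
theorem gsex_PB_eq_rename_cyclicCoverPoly :
    (-(X 1 ^ 2 + X 2 ^ 2 - X 0 - MvPolynomial.C 2) : MvPolynomial (Fin 3) ℂ) =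
      rename (Equiv.swap (0 : Fin 3) 2)
        (cyclicCoverPoly 1 (X 0 ^ 2 + X 1 ^ 2 - MvPolynomial.C 2 : MvPolynomial (Fin 2) ℂ)) := by
  have e0 : (Equiv.swap (0 : Fin 3) 2) (Fin.castSucc (0 : Fin 2)) = 2 := by decide
  have e1 : (Equiv.swap (0 : Fin 3) 2) (Fin.castSucc (1 : Fin 2)) = 1 := by decide
  have e2 : (Equiv.swap (0 : Fin 3) 2) (Fin.last 2) = 0 := by decide
  simp only [cyclicCoverPoly, pow_one, map_sub, map_add, map_pow, rename_X, rename_C, e0, e1, e2]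
  ring

/-- **`y₀² + y₁² - x₀ - 2` is irreducible** (a swap of variables of `X₃ - (X₁² + X₂² - 2)`, which
is irreducible with the conic `X₁² + X₂² - 2`). -/
theorem irreducible_PB :
    Irreducible (X 1 ^ 2 + X 2 ^ 2 - X 0 - MvPolynomial.C 2 : MvPolynomial (Fin 3) ℂ) := by
  have h1 : Irreducible
      (-(X 1 ^ 2 + X 2 ^ 2 - X 0 - MvPolynomial.C 2) : MvPolynomial (Fin 3) ℂ) := by
    rw [gsex_PB_eq_rename_cyclicCoverPoly]
    exact (MulEquiv.irreducible_iff (renameEquiv ℂ (Equiv.swap (0 : Fin 3) 2))).2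
      (irreducible_cyclicCoverPoly_of_irreducible one_pos (irreducible_circlePoly two_ne_zero))
  have h2 : Associated (-(X 1 ^ 2 + X 2 ^ 2 - X 0 - MvPolynomial.C 2) : MvPolynomial (Fin 3) ℂ)
      (X 1 ^ 2 + X 2 ^ 2 - X 0 - MvPolynomial.C 2) := ⟨-1, by simp⟩
  exact h2.irreducible h1

/-- `y₀² + y₁² - x₀ - 2` has the monomials `x₀` and `y₁²`, of different `y₁`-degree. -/
theorem PB_support_pair :
    ∃ m ∈ (X 1 ^ 2 + X 2 ^ 2 - X 0 - MvPolynomial.C 2 : MvPolynomial (Fin 3) ℂ).support,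
      ∃ m' ∈ (X 1 ^ 2 + X 2 ^ 2 - X 0 - MvPolynomial.C 2 : MvPolynomial (Fin 3) ℂ).support, m 2 ≠ m' 2 := by
  classical
  have h20 : (Finsupp.single (2 : Fin 3) 2 : Fin 3 →₀ ℕ) ≠ Finsupp.single 0 1 := by
    intro h; have := DFunLike.congr_fun h 2; simp at this
  have h21 : (Finsupp.single (2 : Fin 3) 2 : Fin 3 →₀ ℕ) ≠ Finsupp.single 1 2 := by
    intro h; have := DFunLike.congr_fun h 2; simp at this
  have h2z : (Finsupp.single (2 : Fin 3) 2 : Fin 3 →₀ ℕ) ≠ 0 := by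
    intro h; have := DFunLike.congr_fun h 2; simp at this
  have h01 : (Finsupp.single (0 : Fin 3) 1 : Fin 3 →₀ ℕ) ≠ Finsupp.single 1 2 := by
    intro h; have := DFunLike.congr_fun h 0; simp at this
  have h0z : (Finsupp.single (0 : Fin 3) 1 : Fin 3 →₀ ℕ) ≠ 0 := by
    intro h; have := DFunLike.congr_fun h 0; simp at this
  refine ⟨Finsupp.single 0 1, ?_, Finsupp.single 2 2, ?_, ?_⟩
  · rw [MvPolynomial.mem_support_iff, MvPolynomial.coeff_sub, MvPolynomial.coeff_sub,
      MvPolynomial.coeff_add, MvPolynomial.coeff_X_pow, MvPolynomial.coeff_X_pow,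
      MvPolynomial.coeff_X, MvPolynomial.coeff_C, if_neg h01.symm, if_neg h20, if_pos rfl,
      if_neg h0z.symm]
    norm_num
  · rw [MvPolynomial.mem_support_iff, MvPolynomial.coeff_sub, MvPolynomial.coeff_sub,
      MvPolynomial.coeff_add, MvPolynomial.coeff_X_pow, MvPolynomial.coeff_X_pow,
      MvPolynomial.coeff_X, MvPolynomial.coeff_C, if_neg h21.symm, if_pos rfl, if_neg h20.symm,
      if_neg h2z.symm]
    norm_num
  · simp

/-- Torus fibres of `y₀² + y₁² = x₀ + 2` over every `t ≠ -1` (`y = (1, √(t+1))`). -/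
theorem PB_torusFibres_infinite :
    Set.Infinite {t : ℂ | ∃ c : Fin 2 → ℂ, c 0 ≠ 0 ∧ c 1 ≠ 0 ∧
      MvPolynomial.eval ![t, c 0, c 1]
        (X 1 ^ 2 + X 2 ^ 2 - X 0 - MvPolynomial.C 2 : MvPolynomial (Fin 3) ℂ) = 0} := by
  refine ((Set.finite_singleton (-1 : ℂ)).infinite_compl).mono ?_
  intro t ht
  have ht' : t + 1 ≠ 0 := fun h => ht (by
    rw [Set.mem_singleton_iff]; linear_combination h)
  obtain ⟨y, hy⟩ := IsAlgClosed.exists_pow_nat_eq (t + 1) two_pos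
  have hy0 : y ≠ 0 := by
    rintro rfl
    rw [zero_pow two_ne_zero] at hy
    exact ht' hy.symm
  refine ⟨![1, y], by simp, by simpa using hy0, ?_⟩
  have e : MvPolynomial.eval ![t, (![1, y] : Fin 2 → ℂ) 0, (![1, y] : Fin 2 → ℂ) 1]
      (X 1 ^ 2 + X 2 ^ 2 - X 0 - MvPolynomial.C 2 : MvPolynomial (Fin 3) ℂ) =
      1 ^ 2 + y ^ 2 - t - 2 := by
    simp
  rw [e, hy]
  ring

/-- **Example B.**  The non-split surface `{x₁ = x₀², y₀² + y₁² = x₀ + 2} ⊆ ℂ² × ℂ²` — a conic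
fibration with an unbalanced edge, named as open after gen 16 — is in Mantova–Masser's case and
its exponential points (`e^{2z} + e^{2z²} = z + 2`) are Zariski dense. (new) -/
theorem unprojectedDensityQuestion_instance_parabola_conicFibration :
    MMCaseDimPiOneFree {w : Fin 2 ⊕ Fin 2 → ℂ |
        w (Sum.inl 1) = (Polynomial.X ^ 2 : Polynomial ℂ).eval (w (Sum.inl 0)) ∧
        MvPolynomial.eval ![w (Sum.inl 0), w (Sum.inr 0), w (Sum.inr 1)]
          (X 1 ^ 2 + X 2 ^ 2 - X 0 - MvPolynomial.C 2 : MvPolynomial (Fin 3) ℂ) = 0} ∧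
      UnprojectedDense {w : Fin 2 ⊕ Fin 2 → ℂ |
        w (Sum.inl 1) = (Polynomial.X ^ 2 : Polynomial ℂ).eval (w (Sum.inl 0)) ∧
        MvPolynomial.eval ![w (Sum.inl 0), w (Sum.inr 0), w (Sum.inr 1)]
          (X 1 ^ 2 + X 2 ^ 2 - X 0 - MvPolynomial.C 2 : MvPolynomial (Fin 3) ℂ) = 0} :=
  unprojectedDensityQuestion_instance_graphSurface (Polynomial.X ^ 2) _ (by simp) irreducible_PB
    PB_support_pair PB_torusFibres_infinite

/-- The same surface in plain coordinates: `{x₁ = x₀², y₀² + y₁² = x₀ + 2}` has Zariski-dense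
exponential points. (new) -/
theorem unprojectedDense_parabola_conicFibration :
    UnprojectedDense {w : Fin 2 ⊕ Fin 2 → ℂ |
      w (Sum.inl 1) = w (Sum.inl 0) ^ 2 ∧ w (Sum.inr 0) ^ 2 + w (Sum.inr 1) ^ 2 = w (Sum.inl 0) + 2} := by
  have h := unprojectedDensityQuestion_instance_parabola_conicFibration.2
  have hset : {w : Fin 2 ⊕ Fin 2 → ℂ |
        w (Sum.inl 1) = (Polynomial.X ^ 2 : Polynomial ℂ).eval (w (Sum.inl 0)) ∧
        MvPolynomial.eval ![w (Sum.inl 0), w (Sum.inr 0), w (Sum.inr 1)]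
          (X 1 ^ 2 + X 2 ^ 2 - X 0 - MvPolynomial.C 2 : MvPolynomial (Fin 3) ℂ) = 0} =
      {w : Fin 2 ⊕ Fin 2 → ℂ |
        w (Sum.inl 1) = w (Sum.inl 0) ^ 2 ∧
          w (Sum.inr 0) ^ 2 + w (Sum.inr 1) ^ 2 = w (Sum.inl 0) + 2} := by
    ext w
    simp only [Set.mem_setOf_eq, Polynomial.eval_pow, Polynomial.eval_X, map_sub, map_add, map_pow,
      MvPolynomial.eval_X, MvPolynomial.eval_C, Matrix.cons_val_zero, Matrix.cons_val_one,
      Matrix.head_cons, Matrix.cons_val_two, Matrix.tail_cons]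
    constructor
    · rintro ⟨h1, h2⟩; exact ⟨h1, by linear_combination h2⟩
    · rintro ⟨h1, h2⟩; exact ⟨h1, by linear_combination h2⟩
  rw [← hset]
  exact h

end Summit.Schanuel.Schanuel.Theorems
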